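import Summits.Ventures.HSemireg.FormulaNUniform
import Summits.Ventures.HSemireg.ContractionRankPointPairBox
import HarnessLib

/-!
# Venture HSemireg — FORMULA-N, the UNIFORM-IN-n STATEMENT on the REAL carriers: `contractionRank A κ = R₂(n) = [t²]P_n(t)²`
# for a point-pair box class on an abelian variety of dimension `2n`, ONE formula for every `n ≥ 2` (no fitted correction)

HONEST FRAMING. Part of the Lean index of the computation cell `pub-hsemireg` (seat p10, Sunday typer «UNIFORM-IN-n»).
THEOREMS ONLY; no variety is constructed, nothing here says that HC / HC_CM / HC_AV holds, no Literature fact is declared.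
p4's real-carrier theorems `contractionRank_pointPairBox` (`r(A, κ) = 6n² − 2n`, `n ≥ 3`) and `contractionRank_pointPairBox_two`
(`= 18`, `n = 2`) — the rank of the polyvector contraction `HT²(A) → Λ H¹(A)`, `ξ ↦ ξ ⌟ κ`, of `PerfectComplexRankDoor.lean`
(`contractionRank`, [BuchweitzFlenner2008HH] Prop. 6.4.4's right-hand side) for a class whose total exterior class splits as
`(a₁ + b₁ω₁) ∧ (a₂ + b₂ω₂)` along `H¹(A) = V₁ ⊕ V₂`, `H^{0,1} = L₁ ⊕ L₂` («`κ = ch(I_p ⊠ I_q)` on `X × X′`», the splitting an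
INPUT by value, exactly as there) — are here stated as ONE formula uniform in `n ≥ 2`:
    `contractionRank A κ = boxRank n 2 = [t²] P_n(t)²`   (`FormulaNUniform.lean`: `boxRank`, `coeff_P_sq`),
the point of FORMULA-N PART A §0 (K) / STRUCTURE.md v1.0-FINAL `9059cdf4f7e18671` §1.1 C2/C3 «(d) = derived exception»: the
`n = 2` value `18 = 20 − 2` is NOT a fitted correction but the same coefficient `[t²](1 + 4t + t²)²`.  The (S1) third number
«`rank σ_E ∘ ev_E = rank ⌟ch(E) = R₂(n)`» thus has its right-hand equality as a tree theorem on the real carriers for every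
`n ≥ 2` (the left-hand equality is the bridge [BF08] Thm 6.4.2, on paper — see `FormulaNUniformLaw.lean`).
-/

noncomputable section

open Module
open Literature.AlgebraicGeometry.Motives Literature.AlgebraicGeometry.HodgeTheory

namespace Summit.Ventures.HSemireg

variable {A : AbelianVariety ℂ} {V₁ V₂ L₁ L₂ : Submodule ℂ (complexBetti A.X 1)}

/-- **`r(A, κ) = R₂(n) = [t²]P_n(t)²` for a point-pair box class on an abelian variety of dimension `2n`, EVERY `n ≥ 2`**
(`18, 48, 88, 140, 204, …`): if `H¹(A) = V₁ ⊕ V₂` with `dim Vᵢ = 2n`, `H^{0,1}(A) = L₁ ⊕ L₂` with `Lᵢ ⊆ Vᵢ` of dimension `n`,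
and the total class of `κ` in `Λ H¹(A)` is `(a₁ + b₁ω₁) ∧ (a₂ + b₂ω₂)` for top forms `ωᵢ ≠ 0` of `Vᵢ` and `aᵢ, bᵢ ≠ 0`, then
`contractionRank A κ = FormulaN.Uniform.boxRank n 2`.  Cases `n ≥ 3` / `n = 2` of p4's two theorems, unified by
`FormulaN.Uniform.boxRank_two` (`R₂(n) = 6n² − 2n`, `n ≥ 3`) and `boxRank 2 2 = 18` (`decide`).
[cite: BuchweitzFlenner2008HH, Prop. 6.4.4] [cite: MumfordAV1970, §1 (4) and §4 (iii)] -/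
theorem contractionRank_pointPairBox_eq_boxRank (hA : IsSmoothProjective A.dim A.X)
    (κ : ∀ p : ℕ, complexBetti A.X (2 * p)) {n : ℕ} (hn : 2 ≤ n)
    (hV : IsCompl V₁ V₂) (hV₁ : Module.finrank ℂ V₁ = 2 * n) (hV₂ : Module.finrank ℂ V₂ = 2 * n)
    (hL : hodgeZeroOne hA = L₁ ⊔ L₂) (hL₁ : L₁ ≤ V₁) (hL₂ : L₂ ≤ V₂)
    (hl₁ : Module.finrank ℂ L₁ = n) (hl₂ : Module.finrank ℂ L₂ = n)
    {ω₁ : ExteriorAlgebra ℂ V₁} (hω₁ : ω₁ ∈ ⋀[ℂ]^(2 * n) V₁) (hω₁0 : ω₁ ≠ 0)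
    {ω₂ : ExteriorAlgebra ℂ V₂} (hω₂ : ω₂ ∈ ⋀[ℂ]^(2 * n) V₂) (hω₂0 : ω₂ ≠ 0)
    {a₁ b₁ a₂ b₂ : ℂ} (ha₁ : a₁ ≠ 0) (hb₁ : b₁ ≠ 0) (ha₂ : a₂ ≠ 0) (hb₂ : b₂ ≠ 0)
    (hx : totalExteriorClass A κ =
      ExteriorAlgebra.map V₁.subtype (algebraMap ℂ _ a₁ + b₁ • ω₁) *
        ExteriorAlgebra.map V₂.subtype (algebraMap ℂ _ a₂ + b₂ • ω₂)) :
    contractionRank A κ = ((FormulaN.Uniform.boxRank n 2 : ℕ) : Cardinal) := by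
  rcases Nat.lt_or_ge n 3 with h2 | h3
  · obtain rfl : n = 2 := by omega
    rw [contractionRank_pointPairBox_two hA κ hV hV₁ hV₂ hL hL₁ hL₂ hl₁ hl₂ hω₁ hω₁0 hω₂ hω₂0 ha₁ hb₁ ha₂ hb₂ hx,
      show FormulaN.Uniform.boxRank 2 2 = 18 by decide]
    norm_num
  · rw [contractionRank_pointPairBox hA κ h3 hV hV₁ hV₂ hL hL₁ hL₂ hl₁ hl₂ hω₁ hω₁0 hω₂ hω₂0 ha₁ hb₁ ha₂ hb₂ hx]
    have h := FormulaN.Uniform.boxRank_two h3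
    have e : 6 * n ^ 2 - 2 * n = FormulaN.Uniform.boxRank n 2 := by omega
    rw [e]

/-- … and as a polynomial coefficient: `contractionRank A κ = [t²] P_n(t)²` read in `ℤ` (`FormulaN.Uniform.coeff_P_sq`). -/
theorem contractionRank_pointPairBox_eq_coeff_P_sq (hA : IsSmoothProjective A.dim A.X)
    (κ : ∀ p : ℕ, complexBetti A.X (2 * p)) {n : ℕ} (hn : 2 ≤ n)
    (hV : IsCompl V₁ V₂) (hV₁ : Module.finrank ℂ V₁ = 2 * n) (hV₂ : Module.finrank ℂ V₂ = 2 * n)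
    (hL : hodgeZeroOne hA = L₁ ⊔ L₂) (hL₁ : L₁ ≤ V₁) (hL₂ : L₂ ≤ V₂)
    (hl₁ : Module.finrank ℂ L₁ = n) (hl₂ : Module.finrank ℂ L₂ = n)
    {ω₁ : ExteriorAlgebra ℂ V₁} (hω₁ : ω₁ ∈ ⋀[ℂ]^(2 * n) V₁) (hω₁0 : ω₁ ≠ 0)
    {ω₂ : ExteriorAlgebra ℂ V₂} (hω₂ : ω₂ ∈ ⋀[ℂ]^(2 * n) V₂) (hω₂0 : ω₂ ≠ 0)
    {a₁ b₁ a₂ b₂ : ℂ} (ha₁ : a₁ ≠ 0) (hb₁ : b₁ ≠ 0) (ha₂ : a₂ ≠ 0) (hb₂ : b₂ ≠ 0)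
    (hx : totalExteriorClass A κ =
      ExteriorAlgebra.map V₁.subtype (algebraMap ℂ _ a₁ + b₁ • ω₁) *
        ExteriorAlgebra.map V₂.subtype (algebraMap ℂ _ a₂ + b₂ • ω₂)) :
    ∃ r : ℕ, contractionRank A κ = (r : Cardinal) ∧ (r : ℤ) = (FormulaN.Uniform.P n ^ 2).coeff 2 :=
  ⟨FormulaN.Uniform.boxRank n 2, contractionRank_pointPairBox_eq_boxRank hA κ hn hV hV₁ hV₂ hL hL₁ hL₂ hl₁ hl₂
    hω₁ hω₁0 hω₂ hω₂0 ha₁ hb₁ ha₂ hb₂ hx, (FormulaN.Uniform.coeff_P_sq n 2).symm⟩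

/-! ## The factor on the real carriers, ONE formula (appended 2026-08-23 by p10) -/

/-- **`r(A, κ) = r₂(g) = [t²]P_g(t)` for a point-ideal class on an abelian variety of dimension `g`, EVERY `g ≥ 2`**
(`1, 6, 12, 20, …` at `g = 2, 3, 4, 5`; th-6's K-SECANT-LIST scope word: here the POINT-PAIR member `a·1 + b·[pt]`, e.g. `ch(I_p)
= 1 − pt`; real pairs / genuine K-secant classes are th-7's `TransversePairLawAt` on the model): if the total class of `κ` in
`Λ H¹(A)` is `a·1 + b·ω` with `a, b ≠ 0` and `ω ≠ 0` of top degree `2g`, then `contractionRank A κ = FormulaN.transversePairRank g 2`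
(`= 2C(g,2) − [g = 2]`).  Cases `g ≥ 3` / `g = 2` of p4's `contractionRank_pointIdeal` (`2·C(g,2)`) and `contractionRank_pointIdeal_two`
(`1` — the two pure lines collapse, FORMULA-N §2.2), unified: the factor column C6 / th-7 Σ1 of STRUCTURE.md on the real
carriers with no case split in the statement.
[cite: BuchweitzFlenner2008HH, Prop. 6.4.4] [cite: MumfordAV1970, §1 (4) and §4 (iii)] -/
theorem contractionRank_pointIdeal_eq_transversePairRank (κ : ∀ p : ℕ, complexBetti A.X (2 * p)) {a b : ℂ}
    (ha : a ≠ 0) (hb : b ≠ 0) {ω : ExteriorAlgebra ℂ (complexBetti A.X 1)}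
    (hω : ω ∈ ⋀[ℂ]^(2 * A.dim) (complexBetti A.X 1)) (hω0 : ω ≠ 0)
    (hx : totalExteriorClass A κ = algebraMap ℂ _ a + b • ω) (hg : 2 ≤ A.dim) :
    contractionRank A κ = ((FormulaN.transversePairRank A.dim 2 : ℕ) : Cardinal) := by
  rcases Nat.lt_or_ge A.dim 3 with h2 | h3
  · have hg2 : A.dim = 2 := by omega
    rw [contractionRank_pointIdeal_two A κ ha hb hω hx hg2, hg2,
      show FormulaN.transversePairRank 2 2 = 1 by decide, Nat.cast_one]
  · rw [contractionRank_pointIdeal A κ ha hb hω hω0 hx h3]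
    congr 1
    unfold FormulaN.transversePairRank
    simp only [show (2 : ℕ) ≠ 0 by omega, show (2 : ℕ) ≠ A.dim by omega, if_false, Nat.sub_zero]

/-- … and as a polynomial coefficient: `contractionRank A κ = [t²] P_g(t)` read in `ℤ` (`FormulaN.Uniform.coeff_P`). -/
theorem contractionRank_pointIdeal_eq_coeff_P (κ : ∀ p : ℕ, complexBetti A.X (2 * p)) {a b : ℂ}
    (ha : a ≠ 0) (hb : b ≠ 0) {ω : ExteriorAlgebra ℂ (complexBetti A.X 1)}
    (hω : ω ∈ ⋀[ℂ]^(2 * A.dim) (complexBetti A.X 1)) (hω0 : ω ≠ 0)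
    (hx : totalExteriorClass A κ = algebraMap ℂ _ a + b • ω) (hg : 2 ≤ A.dim) :
    ∃ r : ℕ, contractionRank A κ = (r : Cardinal) ∧ (r : ℤ) = (FormulaN.Uniform.P A.dim).coeff 2 :=
  ⟨FormulaN.transversePairRank A.dim 2, contractionRank_pointIdeal_eq_transversePairRank κ ha hb hω hω0 hx hg,
    (FormulaN.Uniform.coeff_P A.dim 2).symm⟩

end Summit.Ventures.HSemireg

end
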